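import Summits.BirchSwinnertonDyer.BirchSwinnertonDyer.Theorems.ThetaPartnerAtTwoSignedControlAtTwoPlusCyclicOfHonda
import Summits.BirchSwinnertonDyer.BirchSwinnertonDyer.Theorems.ThetaPartnerAtTwoSignedKatoUpToAtTwoLocalTwoLayerTorsion
import Summits.BirchSwinnertonDyer.BirchSwinnertonDyer.Theorems.ByReductionTypeAtTwoSupersingularTowerTorsionTwo
import Literature.NumberTheory.EllipticCurves.Sprung2012.LocalTowerLayersProofs
import HarnessLib

/-!
# Route `ThetaPartnerAtTwo` (TP2), crux K3 `SignedKatoDivisibilityUpToAtTwo` (item stmt-BirchSwinnertonDyer-20308),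
# line `colemanrat` v3 — THE LOCAL THEORY AT `p = 2`, file 11: KOBAYASHI'S PROP. 8.12 ii) INTERSECTION HALF
# `E⁺(K_n·K_v) ∩ E⁻(K_n·K_v) = E(K_v)` for the tree's signed local points `Kobayashi2003.signedLocalPointsOfEmb`
# along ANY `ℤ_p`-extension (any `K`, `p`, `κ`, `ι`, under «no `p`-torsion in `E(K_∞·K_v)`»), and UNCONDITIONALLY at
# `p = 2` for `W/ℚ` globally minimal with `GoodSS W 2` (the binders of K3)

Width seat `bsd-wall-tp2-p2x-w3` g2 (cell `bsd-wall`). HONEST FRAMING: THEOREMS ONLY — no definition, no named fact, no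
instance, no `sorry`; route-independent (no `Theses` import); nothing about any Selmer group is asserted; closes no item;
BSD is NOT proved by any of this.

## Why this file (residue (a) of the lead's port memo `Cruxes/SignedKatoDivisibilityUpToAtTwo/G2-PORT-AT-2.md` §8)

Kobayashi, Invent. Math. 152 (2003), Prop. 8.12 ii) (p. 17): «`C(m_n) ∩ C(m_{n−1}) = F_ss(m_{−1})` and
`F_ss(m_n) = C(m_n) + C(m_{n−1})`», i.e. for the `±` subgroups of Def. 1.1: `E⁺(F_{n,p}) ∩ E⁻(F_{n,p}) = E(ℚ_p)` and
`E(F_{n,p}) = E⁺ + E⁻` (the exact sequence (8.22)). The GENERATION half `E = E⁺ + E⁻` along the `μ_{p^∞}`-tower at `p = 2`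
is the lead's files 7/10 (`…LocalTwoSignedGeneration`, `…LocalTwoCyclotomicTower`); along the `ℤ₂`-tower it is the K4
seats' HONDA⁺@2 system (`SignedEC.plusCyclic_of_honda`). This file is the INTERSECTION half, for the crux's OWN objects
(`signedLocalPointsOfEmb κ ι W (±1) n` over the layers `K_n·K_v` of an arbitrary `ℤ_p`-extension `κ`), by Kobayashi's own
argument (proof of Prop. 8.12, p. 18): if `P ∈ E⁺_n ∩ E⁻_n` lies in `E(K_{m+1}·K_v)` with `m < n`, then — whatever the
parity of `m` — one of the two signed conditions says `Tr_{n/m+1} P ∈ E(K_m·K_v)`, and `Tr_{n/m+1} P = [K_n·K_v :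
K_{m+1}·K_v] · P` with the index a divisor of `pⁿ`; with no `p`-torsion in the tower, `P ∈ E(K_m·K_v)` (Prop. 8.7 / the
K4 seats' layer descent `SignedEC.mem_localLayerPointsOfEmb_of_dvd_pow_nsmul_mem`); descending induction ends in
`E(K_0·K_v) = E(K_v)`. Hence `Hom_{ℤ_p}(E⁺_∞ + E⁻_∞, ·)` sees `E⁺_∞ ⊕ E⁻_∞` exactly modulo the diagonal `E(K_v)` — the
shape in which the `±` Coleman functionals of K3's package are assembled (Kobayashi (8.22), Cor. 8.13).

## What is proved

* §1 (any `K`, `p`, `κ : ZpExtension K p`, `K`-field `E` with `ι : K̄ → K̄_E`, `W/K`; hypothesis (NT) «`E(K_∞·K_v)` has no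
  `p`-torsion»): `mem_localLayerPointsOfEmb_zero_of_mem_signedLocalPointsOfEmb_of_neg` (`P ∈ E^ε_n ∩ E^{−ε}_n ⇒ P ∈
  E(K_0·K_v)`), `signedLocalPointsOfEmb_inf_neg_eq` (`E^ε_n ⊓ E^{−ε}_n = E(K_0·K_v)`), and the `±` spellings
  `signedLocalPointsOfEmb_one_inf_neg_one_eq`.
* §2 (`K = ℚ`, `p = 2`, `W` globally minimal, `GoodSS W 2`, ANY `ℤ₂`-extension `κ`): (NT) discharged — over the completion
  `v.adicCompletion ℚ` at the place `v ∋ 2` by the `bsd-2adic` cell's `SSFlatEC.eq_zero_of_mem_localTowerPointsOfEmb_of_two_nsmul`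
  (Sprung's Lemma 2.3 at `2`), and over `ℚ_[2]` by the lead's `LocalTwo.eq_zero_of_two_pow_smul_eq_zero_localLayerPointsOfEmb`
  (Prop. 8.7 at `2`) + `E(K_∞·K_v) = ⋃_n E(K_n·K_v)`; hence `E⁺(K_n·ℚ₂) ∩ E⁻(K_n·ℚ₂) = E(ℚ₂)` unconditionally in K3's binders
  (`signedLocalPointsOfEmb_one_inf_neg_one_eq_two_adicCompletion`, `…_two_padic`).

References: [Kobayashi2003] S. Kobayashi, Invent. Math. 152 (2003), Def. 1.1 (p. 2), Prop. 8.7 (p. 16), Prop. 8.12 ii) and its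
proof (pp. 17–18), (8.22); [Sprung2012] F. Sprung, J. Number Theory 132 (2012), Lemma 2.3 (p. 1487), Lemma 7.10 (p. 1503).
-/

set_option autoImplicit false
-- the Theorems namespace of this sub repeats the summit name by design (D-0017 nested layout)
set_option linter.dupNamespace false

noncomputable section

open scoped Classical

namespace Summit.BirchSwinnertonDyer.BirchSwinnertonDyer.Theorems

namespace SignedKatoOffTwo.SignedIntersection

open WeierstrassCurve Literature.NumberTheory.EllipticCurves Literature.NumberTheory.EllipticCurves.Rank1Residual
  Literature.NumberTheory.EllipticCurves.Kobayashi2003 Literature.NumberTheory.EllipticCurves.Sprung2012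
  Literature.NumberTheory.GaloisRepresentations ZpExtension NumberField IsDedekindDomain

universe u

/-! ## §1 `E^ε_n ∩ E^{−ε}_n = E(K_0·K_v)` under «no `p`-torsion in the tower» -/

section General

variable {K : Type u} [Field K] (W : WeierstrassCurve K) {p : ℕ} [Fact p.Prime] (κ : ZpExtension K p)
  {E : Type u} [Field E] [Algebra K E] (ι : AlgebraicClosure K →ₐ[K] AlgebraicClosure E)

/-- A unit of `ℤ` other than `ε` is `−ε`. [folklore] -/
theorem units_int_eq_neg_of_ne {u ε : ℤˣ} (h : u ≠ ε) : u = -ε := by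
  rcases Int.units_eq_one_or u with hu | hu <;> rcases Int.units_eq_one_or ε with hε | hε <;>
    subst hu <;> subst hε <;> simp_all

/-- **One step of Kobayashi's descent** (proof of Prop. 8.12, p. 18): a point of `E^ε_n ∩ E^{−ε}_n` lying in
`E(K_{m+1}·K_v)`, `m < n`, lies in `E(K_m·K_v)` — whichever sign `(−1)^m` has, the matching signed condition gives
`Tr_{n/m+1} P = [K_n·K_v : K_{m+1}·K_v] · P ∈ E(K_m·K_v)`, the index divides `pⁿ`, and `p`-power divisibility descends the
layers when `E(K_∞·K_v)` has no `p`-torsion. [cite: Kobayashi2003, proof of Prop. 8.12 ii) (p. 18)] -/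
theorem mem_localLayerPointsOfEmb_of_mem_succ_of_mem_signedLocalPointsOfEmb_of_neg
    (hnt : ∀ P ∈ localTowerPointsOfEmb κ ι W, p • P = 0 → P = 0) (ε : ℤˣ) {m n : ℕ} (hmn : m < n)
    {P : localPoints W E} (hP : P ∈ signedLocalPointsOfEmb κ ι W ε n)
    (hP' : P ∈ signedLocalPointsOfEmb κ ι W (-ε) n) (hPm : P ∈ localLayerPointsOfEmb κ ι W (m + 1)) :
    P ∈ localLayerPointsOfEmb κ ι W m := by
  -- the trace `Tr_{n/m+1} P` lies in `E(K_m·K_v)` by one of the two signed conditions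
  have htr : localTraceOfEmb κ ι W (m + 1) n P ∈ localLayerPointsOfEmb κ ι W m := by
    by_cases hε : (m : ℤ).negOnePow = ε
    · exact hP.2 m hmn hε
    · exact hP'.2 m hmn (units_int_eq_neg_of_ne hε)
  -- and equals `[K_n·K_v : K_{m+1}·K_v] • P`
  rw [localTraceOfEmb_apply_of_mem_lower κ ι W (m + 1) n hPm] at htr
  exact SignedEC.mem_localLayerPointsOfEmb_of_dvd_pow_nsmul_mem W κ ι hnt m
    (SignedEC.index_subgroupOf_localLayerSubgroupOfEmb_dvd κ ι (Nat.succ_le_of_lt hmn))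
    (localLayerPointsOfEmb_le_localTowerPointsOfEmb κ ι W (m + 1) hPm) htr

/-- **Kobayashi's Prop. 8.12 ii), intersection half, on the tree's signed local points**: a point of
`E^ε(K_n·K_v) ∩ E^{−ε}(K_n·K_v)` lies in `E(K_0·K_v) = E(K_v)` (descending induction on the layer, no `p`-torsion in
`E(K_∞·K_v)`). [cite: Kobayashi2003, Prop. 8.12 ii) (p. 17) and its proof (p. 18)] -/
theorem mem_localLayerPointsOfEmb_zero_of_mem_signedLocalPointsOfEmb_of_neg
    (hnt : ∀ P ∈ localTowerPointsOfEmb κ ι W, p • P = 0 → P = 0) (ε : ℤˣ) (n : ℕ)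
    {P : localPoints W E} (hP : P ∈ signedLocalPointsOfEmb κ ι W ε n)
    (hP' : P ∈ signedLocalPointsOfEmb κ ι W (-ε) n) : P ∈ localLayerPointsOfEmb κ ι W 0 := by
  -- `P ∈ E(K_{n−k}·K_v)` for every `k ≤ n`
  have key : ∀ k, k ≤ n → P ∈ localLayerPointsOfEmb κ ι W (n - k) := by
    intro k
    induction k with
    | zero => exact fun _ ↦ by simpa using hP.1
    | succ k ih =>
      intro hk
      have hlt : n - (k + 1) < n := by omega
      have heq : n - (k + 1) + 1 = n - k := by omega
      exact mem_localLayerPointsOfEmb_of_mem_succ_of_mem_signedLocalPointsOfEmb_of_neg W κ ι hnt ε hlt hP hP'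
        (heq ▸ ih (Nat.le_of_succ_le hk))
  simpa using key n le_rfl

/-- **`E^ε(K_n·K_v) ⊓ E^{−ε}(K_n·K_v) = E(K_0·K_v)`** (Kobayashi Prop. 8.12 ii): `C(m_n) ∩ C(m_{n−1}) = F_ss(m_{−1})`,
read for Def. 1.1 over the `ℤ_p`-layers: `E⁺(F_{n,p}) ∩ E⁻(F_{n,p}) = E(ℚ_p)`), for ANY `ℤ_p`-extension with no `p`-torsion
in `E(K_∞·K_v)`; `⊇` is the tree's `localLayerPointsOfEmb_zero_le_signedLocalPointsOfEmb`.
[cite: Kobayashi2003, Prop. 8.12 ii) (p. 17), (8.22)] -/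
theorem signedLocalPointsOfEmb_inf_neg_eq
    (hnt : ∀ P ∈ localTowerPointsOfEmb κ ι W, p • P = 0 → P = 0) (ε : ℤˣ) (n : ℕ) :
    signedLocalPointsOfEmb κ ι W ε n ⊓ signedLocalPointsOfEmb κ ι W (-ε) n = localLayerPointsOfEmb κ ι W 0 :=
  le_antisymm
    (fun _ hP ↦ mem_localLayerPointsOfEmb_zero_of_mem_signedLocalPointsOfEmb_of_neg W κ ι hnt ε n hP.1 hP.2)
    (le_inf (localLayerPointsOfEmb_zero_le_signedLocalPointsOfEmb κ ι W ε n)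
      (localLayerPointsOfEmb_zero_le_signedLocalPointsOfEmb κ ι W (-ε) n))

/-- The `±` spelling: **`E⁺(K_n·K_v) ⊓ E⁻(K_n·K_v) = E(K_0·K_v)`** under no `p`-torsion in the tower.
[cite: Kobayashi2003, Prop. 8.12 ii) (p. 17), (8.22)] -/
theorem signedLocalPointsOfEmb_one_inf_neg_one_eq
    (hnt : ∀ P ∈ localTowerPointsOfEmb κ ι W, p • P = 0 → P = 0) (n : ℕ) :
    signedLocalPointsOfEmb κ ι W 1 n ⊓ signedLocalPointsOfEmb κ ι W (-1) n = localLayerPointsOfEmb κ ι W 0 :=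
  signedLocalPointsOfEmb_inf_neg_eq W κ ι hnt 1 n

/-- Point form of the `±` spelling: `P ∈ E⁺_n`, `P ∈ E⁻_n` ⇒ `P` is fixed by all of `Γ_{K_v}` (`P ∈ E(K_v)`).
[cite: Kobayashi2003, Prop. 8.12 ii) (p. 17)] -/
theorem forall_smul_eq_of_mem_plus_of_mem_minus
    (hnt : ∀ P ∈ localTowerPointsOfEmb κ ι W, p • P = 0 → P = 0) (n : ℕ) {P : localPoints W E}
    (hP : P ∈ signedLocalPointsOfEmb κ ι W 1 n) (hP' : P ∈ signedLocalPointsOfEmb κ ι W (-1) n) :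
    ∀ τ : Field.absoluteGaloisGroup E, τ • P = P :=
  (mem_localLayerPointsOfEmb_zero_iff κ ι W P).1
    (mem_localLayerPointsOfEmb_zero_of_mem_signedLocalPointsOfEmb_of_neg W κ ι hnt 1 n hP hP')

/-- **Uniqueness of the `±` decomposition modulo `E(K_v)`**: if `a + b = a' + b'` with `a, a' ∈ E⁺_n` and `b, b' ∈ E⁻_n`,
then `a − a' = b' − b ∈ E(K_0·K_v)` — exactness of Kobayashi's (8.22) `0 → E(K_v) → E⁺_n ⊕ E⁻_n → E_n` at the middle,
under no `p`-torsion in the tower. [cite: Kobayashi2003, Prop. 8.12 ii), (8.22) (p. 17)] -/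
theorem sub_mem_localLayerPointsOfEmb_zero_of_add_eq_add
    (hnt : ∀ P ∈ localTowerPointsOfEmb κ ι W, p • P = 0 → P = 0) (n : ℕ) {a a' b b' : localPoints W E}
    (ha : a ∈ signedLocalPointsOfEmb κ ι W 1 n) (ha' : a' ∈ signedLocalPointsOfEmb κ ι W 1 n)
    (hb : b ∈ signedLocalPointsOfEmb κ ι W (-1) n) (hb' : b' ∈ signedLocalPointsOfEmb κ ι W (-1) n)
    (h : a + b = a' + b') : a - a' ∈ localLayerPointsOfEmb κ ι W 0 := by
  have hab : a - a' = b' - b := sub_eq_sub_iff_add_eq_add.mpr (by rw [h, add_comm])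
  refine mem_localLayerPointsOfEmb_zero_of_mem_signedLocalPointsOfEmb_of_neg W κ ι hnt 1 n (sub_mem ha ha') ?_
  rw [hab]
  exact sub_mem hb' hb

end General

/-! ## §2 `p = 2`: the hypothesis discharged on the habitat of K3 (`W/ℚ` globally minimal, `GoodSS W 2`) -/

section Two

variable (W : WeierstrassCurve ℚ) [W.IsGloballyMinimal]

/-- (NT) at `p = 2` over the completion at the place `v ∋ 2`: `E(K_∞·ℚ_v)` has no `2`-torsion for EVERY `ℤ₂`-extension `κ`
of `ℚ` and every embedding — the `bsd-2adic` cell's `SSFlatEC.eq_zero_of_mem_localTowerPointsOfEmb_of_two_nsmul`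
(Sprung's Lemma 2.3 at `2`), repackaged in the shape (NT) of §1. [cite: Sprung2012, Lemma 2.3 (p. 1487)]
[cite: Kobayashi2003, Prop. 8.7 (p. 16)] -/
theorem noTwoTorsion_localTowerPointsOfEmb_adicCompletion [W.IsElliptic] (hss : GoodSS W 2) (κ : ZpExtension ℚ 2)
    (v : HeightOneSpectrum (𝓞 ℚ)) (hv : (2 : 𝓞 ℚ) ∈ v.asIdeal)
    (ι : AlgebraicClosure ℚ →ₐ[ℚ] AlgebraicClosure (v.adicCompletion ℚ)) :
    ∀ P ∈ localTowerPointsOfEmb κ ι W, 2 • P = 0 → P = 0 :=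
  fun _ hP h2 ↦ SSFlatEC.eq_zero_of_mem_localTowerPointsOfEmb_of_two_nsmul W hss κ hv ι hP h2

/-- (NT) at `p = 2` over `ℚ_[2]`: `E(K_∞·ℚ₂)` has no `2`-torsion for EVERY `ℤ₂`-extension `κ` of `ℚ` and every embedding
(every tower point lies in a layer, Sprung Lemma 7.10, and the layers have no `2`-power torsion by the lead's Prop. 8.7 at
`2`, `LocalTwo.eq_zero_of_two_pow_smul_eq_zero_localLayerPointsOfEmb`). [cite: Kobayashi2003, Prop. 8.7 (p. 16)]
[cite: Sprung2012, Lemma 7.10 (p. 1503)] -/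
theorem noTwoTorsion_localTowerPointsOfEmb_padic (hss : GoodSS W 2) (κ : ZpExtension ℚ 2)
    (ι : AlgebraicClosure ℚ →ₐ[ℚ] AlgebraicClosure ℚ_[2]) :
    ∀ P ∈ localTowerPointsOfEmb κ ι W, 2 • P = 0 → P = 0 := by
  intro P hP h2
  obtain ⟨n, hn⟩ := exists_mem_localLayerPointsOfEmb_of_mem_localTowerPointsOfEmb κ ι W hP
  exact LocalTwo.eq_zero_of_two_pow_smul_eq_zero_localLayerPointsOfEmb W hss κ ι n hn (k := 1) (by rwa [pow_one])

/-- **`E⁺(K_n·ℚ_v) ∩ E⁻(K_n·ℚ_v) = E(ℚ_v)` UNCONDITIONALLY at `p = 2`** (`v` the place of `ℚ` above `2`, `W/ℚ` globally minimal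
with `GoodSS W 2`, any `ℤ₂`-extension `κ`, any embedding `ι`, any `n`) — Kobayashi's Prop. 8.12 ii) (intersection half) for
the crux's own objects in the binders of K3 `SignedKatoDivisibilityUpToAtTwo`. [cite: Kobayashi2003, Prop. 8.12 ii) (p. 17)] -/
theorem signedLocalPointsOfEmb_one_inf_neg_one_eq_two_adicCompletion [W.IsElliptic] (hss : GoodSS W 2) (κ : ZpExtension ℚ 2)
    (v : HeightOneSpectrum (𝓞 ℚ)) (hv : (2 : 𝓞 ℚ) ∈ v.asIdeal)
    (ι : AlgebraicClosure ℚ →ₐ[ℚ] AlgebraicClosure (v.adicCompletion ℚ)) (n : ℕ) :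
    signedLocalPointsOfEmb κ ι W 1 n ⊓ signedLocalPointsOfEmb κ ι W (-1) n = localLayerPointsOfEmb κ ι W 0 :=
  signedLocalPointsOfEmb_one_inf_neg_one_eq W κ ι (noTwoTorsion_localTowerPointsOfEmb_adicCompletion W hss κ v hv ι) n

/-- The same over `ℚ_[2]`: **`E⁺(K_n·ℚ₂) ∩ E⁻(K_n·ℚ₂) = E(ℚ₂)`** unconditionally for `W/ℚ` globally minimal with
`GoodSS W 2`, any `ℤ₂`-extension, embedding and layer. [cite: Kobayashi2003, Prop. 8.12 ii) (p. 17)] -/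
theorem signedLocalPointsOfEmb_one_inf_neg_one_eq_two_padic (hss : GoodSS W 2) (κ : ZpExtension ℚ 2)
    (ι : AlgebraicClosure ℚ →ₐ[ℚ] AlgebraicClosure ℚ_[2]) (n : ℕ) :
    signedLocalPointsOfEmb κ ι W 1 n ⊓ signedLocalPointsOfEmb κ ι W (-1) n = localLayerPointsOfEmb κ ι W 0 :=
  signedLocalPointsOfEmb_one_inf_neg_one_eq W κ ι (noTwoTorsion_localTowerPointsOfEmb_padic W hss κ ι) n

/-- General-sign form at `p = 2` over the completion at `v ∋ 2`: `E^ε_n ⊓ E^{−ε}_n = E(ℚ_v)`.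
[cite: Kobayashi2003, Prop. 8.12 ii) (p. 17)] -/
theorem signedLocalPointsOfEmb_inf_neg_eq_two_adicCompletion [W.IsElliptic] (hss : GoodSS W 2) (κ : ZpExtension ℚ 2)
    (v : HeightOneSpectrum (𝓞 ℚ)) (hv : (2 : 𝓞 ℚ) ∈ v.asIdeal)
    (ι : AlgebraicClosure ℚ →ₐ[ℚ] AlgebraicClosure (v.adicCompletion ℚ)) (ε : ℤˣ) (n : ℕ) :
    signedLocalPointsOfEmb κ ι W ε n ⊓ signedLocalPointsOfEmb κ ι W (-ε) n = localLayerPointsOfEmb κ ι W 0 :=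
  signedLocalPointsOfEmb_inf_neg_eq W κ ι (noTwoTorsion_localTowerPointsOfEmb_adicCompletion W hss κ v hv ι) ε n

end Two

end SignedKatoOffTwo.SignedIntersection

end Summit.BirchSwinnertonDyer.BirchSwinnertonDyer.Theorems

end
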